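import Summits.QuantumFields.BalabanUV.Beta.FP.PeriodisedBorderWardContactTwo
import Summits.QuantumFields.BalabanUV.Beta.BorderWardSiteLaw
import Summits.QuantumFields.BalabanUV.Beta.CombWilsonT2PeriodisedK2

/-!
# `BalabanUV.Beta.FP.PeriodisedBorderIndexWardTwo` — road «FP» for binder row D1, ROUTE T, (T-β-m) ORDER 2 AT EVERY DEPTH, PART 1:
# **THE ROOTED SECOND-ORDER BORDER PAIR ALONG A TORUS PURE GAUGE IN ONE BOND IS THE COMMUTATOR OF THE FIRST-ORDER ROOTED MEMBER AT THE OTHER BOND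
# WITH THE DIAGONAL GAUGE GENERATORS** — the ROOTED twin (generic `d`, any root `ρ = toSite r`, any box `M = L·M′`, any multiplier presentation) of my g22
# B1 ∕ B2 `PeriodisedSymBorderT2IndexWard(Snd)` (which are `d = 3`, chart (III′), `symVh₂SAn1`), for the SYMMETRISED packed pair of an1's `vh₂SAt ρ` that my g25
# I-2 ∕ I-3 (`PeriodisedBorderWardContactTwo` ∕ `TorusCompositeCovarianceTwoStep.stepIns₂`) periodise

WHY.  #21 `NestedStepLawTorusCompositeOneShotTop` displays the (T-β-m) letter `q2 : X̄X̄𝔔₀ + 2(X̄𝔔₁ + X̄𝔔₀X) + 𝔔₂ + 2𝔔₁X + 𝔔₀XX = 𝔔′₂`; `q1` is my g22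
`TorusCompositeIndexWardOne.torus_q1_tower` (built on g18's ORDER-1 index law `PeriodisedBorderIndexWard`); `q2` BY TERM needs the ORDER-2 index law of the rooted
pair on the torus — how `stepIns₂ (w + Dμ)` expands — i.e. the periodisation of an2's site-level border Ward law (W2-B) `BorderWardSiteLaw.vh2KerAt_siteWard`
(general `d`, any root; consumed BY NAME).  This file is that periodisation; the tower (`compIns₂` along `h + Dλ`, `torus_q2_tower`) is the sequel.

WHAT (`M = L·M′`; `P κ u κ′ u′ := ½(vh₂SAt ρ L κ u κ′ u′ + vh₂SAt ρ L κ′ u′ κ u)`; I-2's second-bond-periodised family `V κ u := Σ'_n P κ u κ′ (u′ + M∘n)`; torus pair member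
`T^{b,β} := (perF M (dper M (V^{β} b.2 ↑b.1))).submatrix (pμ·, inr mμ·) (·.1, inl ·.2)`, first-order member `M^{β} := (perF M (dper M (vhSAt ρ d L rfl β.2 ↑β.1))).submatrix …`):
§1 `sum_pair_sub_inr_inl` — (W2-B) through node 7a's packing on the `(inr μ, inl α)` block: `Σ_κ (P κ (w − e_κ) κ′ u′ − P κ w κ′ u′) x z (inr μ)(inl α)
= ([x + ρ = w] − [z = w])·vhSAt ρ d L rfl κ′ u′ x z (inr μ)(inl α)` (sign PLUS, no constant); §2 `sum_borderT2_sub_inr_inl` (the engine's `hlaw` shape, copy by copy)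
and, by an2's period-lattice engine `CombWilsonT2Periodised.sum_tgrad_mul_perZ_dper_of_indexLaw_periodCov` fed I-2's covariance ∕ window letters,
**`sum_tgrad_mul_perZ_dper_borderT2`**; §3 the matrix forms **`torus_T2_pureGauge_fst_of_presentation`** ∕ `_fun_`: `Σ_b (Dλ)_b • T^{b,β} = R_λ·M^{β} − M^{β}·E_λ`,
`E_λ = diagonal (λ b.1)`, `R_λ = diagonal (Σ_s tdelta M (pμ a + ρ) s·λ s)` (g18's rotations; NO `c_j`); §4 the pair swap on the `(inr, inl)` block
(`dper_borderT2_swap_inr_inl`: finite-rectangle Fubini — the symmetrised pair needs no anti-twin) ⟹ **`torus_T2_pureGauge_snd_fun_of_presentation`** and the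
bi-weighted forms **`torus_T2_gauge_fst ∕ snd_of_presentation`**.  [folklore] finite sums + `tsum` bookkeeping BY NAME; no `def`, no `def … : Prop`, nothing cited,
0 sorry.  Nothing of the dictionary ∕ Bałaban's asserted (that `vh₂SAt` IS the one-step averaging's second border jet is an2's TABLE word).

HONEST DEPENDENCY (page 1, mandatory): continuum YM on T⁴ ⇐ BetaPertH ∧ nine spine estimates (0/9 proved); BetaPertH ⇐ (D1) ∧ (D4) ∧ CAP+tail;
G-an2-4 gates asym, D1 and NE2/3/4.  HONEST FRAMING (cell contract, verbatim): «discharging `BetaPertH` makes Bałaban's UV stability UNCONDITIONAL —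
a real constructive-QFT result; it is NOT the continuum limit and NOT the Clay problem.»  ABSOLUTE RULE (cell charter, verbatim): «No internally-minted
statement may enter as a cited fact. Every hypothesis is either kernel-proved in this package or a verbatim quotation of a PUBLISHED theorem with page
reference. The manuscript(s) under audit are NOT citable for their own disputed steps — they are the thing under adjudication; programme-internal
(2001/route/tribunal) claims are never citable.»  0 estimates; 0∕4 row-D1 binders (hW, hR, D1Tel, D1Rep); NOT (T-ID), NOT (J-a) complete, NOT SDF, NOT D1,
NOT BetaPertH, NOT continuum, NOT Clay.  D1 formalisation swarm LEAF PROVER 02 (b2b-balaban-beta-d1-formalise-leaf-02 gen 26), 2026-08-23.  No existing file touched.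
-/

noncomputable section

open scoped BigOperators

namespace Summit.QuantumFields.BalabanUV.Beta.FP.PeriodisedBorderIndexWardTwo

open Finset Matrix
open Literature.MathematicalPhysics.QuantumFieldTheory.Balaban1983to89
open Literature.MathematicalPhysics.QuantumFieldTheory.Balaban1983to89.Beta
open B4TorusKernel.MultiPeriod (translate translate_apply)
open ExpKernelCalculus (MKer)
open B6Lemma24Torus (pbox mem_pbox)
open AffineAveraging (Site box toSite unitVec)
open AveragingContours (blk off)
open AveragingHessianKernels (eq_smul_blk_of_off_eq_zero)
open AveragingHessianKernelsRooted (vhSAt vhSAt_translate)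
open AveragingMixedJetTables (vh₂SAt)
open OneStepResolventKernel (Fib)
open Summit.QuantumFields.BalabanUV.Beta.BorderWardSiteLaw (vh2KerAt_siteWard)
open Summit.QuantumFields.BalabanUV.Beta.FP.KernelPeriodisationFib (Idx perF perF_apply perZ perZ_apply)
open Summit.QuantumFields.BalabanUV.Beta.FP.KernelPeriodisationFibLoc (dper dper_apply)
open Summit.QuantumFields.BalabanUV.Beta.FP.TorusGaugeCovariance (tdelta tgrad nearBox mem_nearBox)
open Summit.QuantumFields.BalabanUV.Beta.FP.TorusGaugeCovariancePairing (sum_tdelta_mul wrapPt_of_mem)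
open Summit.QuantumFields.BalabanUV.Beta.FP.PeriodisedBorderTables (dper_apply_of_blockCov)
open Summit.QuantumFields.BalabanUV.Beta.FP.PeriodisedBorderIndexWard (translate_injective)
open Summit.QuantumFields.BalabanUV.Beta.FP.PeriodisedBorderWardContactTwo (vh₂SAt_inr_inl_eq vhSAt_inr_inl_eq' pair_inr_inl_eq_zero_of_not_mem
  summable_pair_translate_inr_inl borderT2_periodCov borderT2_inr_inl_eq_zero_of_not_mem_T borderT2_inr_inl_eq_zero_of_not_mem_S dper_vhSAt_inr_inl_eq_zero_of_not_mem)
open Summit.QuantumFields.BalabanUV.Beta.CombWilsonT2Periodised (dper_apply_of_periodCov sum_tgrad_mul_perZ_dper_of_indexLaw_periodCov)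
open Summit.QuantumFields.BalabanUV.Beta.CombWilsonT2PeriodisedK2 (tsum_tsum_comm_of_support)

variable {d : ℕ}

/-! ## §1 The kernel letter: (W2-B) through the packing, on the `(inr μ, inl α)` block -/

section Lattice

variable {L : ℕ}

open Classical in
/-- [folklore] **an2's SITE-LEVEL BORDER WARD LAW (W2-B) `BorderWardSiteLaw.vh2KerAt_siteWard` READ THROUGH node 7a's PACKING, `(inr μ, inl α)` BLOCK** (any root
`ρ`, `1 ≤ L`; multiplier leg packed at `x`, fluctuation leg `(α, z)`, the OTHER bond `(κ′, u′)`): for the SYMMETRISED packed pair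
`P κ u κ′ u′ := ½(vh₂SAt ρ L κ u κ′ u′ + vh₂SAt ρ L κ′ u′ κ u)`,
`Σ_κ (P κ (w − e_κ) κ′ u′ − P κ w κ′ u′) x z (inr μ) (inl α) = ([x + ρ = w] − [z = w]) · vhSAt ρ d L rfl κ′ u′ x z (inr μ) (inl α)` — a pure gauge `δ_w` in ONE bond of
the pair is the first-order member at the OTHER bond, rotated at the ROOT `x + ρ` of the multiplier's block MINUS rotated at the fluctuation leg's site; sign PLUS,
no constant. -/
theorem sum_pair_sub_inr_inl (hL : 1 ≤ L) (ρ : Site (d + 1)) (κ' : Fin (d + 1)) (u' w x z : Site (d + 1)) (μ α : Fin (d + 1)) :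
    ∑ κ : Fin (d + 1), ((1 / 2 : ℝ) * (vh₂SAt ρ L κ (w - unitVec κ) κ' u' x z (Sum.inr μ) (Sum.inl α) + vh₂SAt ρ L κ' u' κ (w - unitVec κ) x z (Sum.inr μ) (Sum.inl α))
        - (1 / 2 : ℝ) * (vh₂SAt ρ L κ w κ' u' x z (Sum.inr μ) (Sum.inl α) + vh₂SAt ρ L κ' u' κ w x z (Sum.inr μ) (Sum.inl α)))
      = ((if x + ρ = w then (1 : ℝ) else 0) - (if z = w then 1 else 0)) * vhSAt ρ d L rfl κ' u' x z (Sum.inr μ) (Sum.inl α) := by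
  simp only [vh₂SAt_inr_inl_eq, vhSAt_inr_inl_eq']
  by_cases hx : off L x = 0
  · simp only [hx, if_true]
    rw [vh2KerAt_siteWard (by omega) ρ μ (blk L x) w (α, z) (κ', u'), ← eq_smul_blk_of_off_eq_zero hL hx, mul_comm]
    congr 2
    · simp only [eq_comm]
    · simp only [eq_comm]
  · simp [hx]

end Lattice

/-! ## §2 I-2's second-bond-periodised rooted pair: the first-slot index law in `hlaw` shape; the engine -/

section Family

variable {M M' : Fin (d + 1) → ℕ} [∀ μ, NeZero (M μ)] {L : ℕ} [NeZero L] {r : Fin (d + 1) → ℕ} (hr : r ∈ box (d + 1) L) (κ' : Fin (d + 1)) (u' : Site (d + 1))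
  {V : Fin (d + 1) → Site (d + 1) → MKer (d + 1) (Fib d)}
include hr

/-- [folklore] **`sum_borderT2_sub_inr_inl` — THE FIRST-SLOT INDEX LAW OF I-2's SECOND-BOND-PERIODISED ROOTED PAIR** in the engine's `hlaw` shape on the `(inr, inl)`
block (`M = L·M′`): for `V κ u := Σ'_n ½(S₂ κ u κ′ (u′+M∘n) + S₂ κ′ (u′+M∘n) κ u)`,
`Σ_κ (V κ (w − e_κ) − V κ w) x z (inr μ) (inl α) = ([x + ρ = w] − [z = w]) · dper M (vhSAt ρ d L rfl κ′ u′) x z (inr μ) (inl α)` — §1 for each copy `u′ + M∘n` of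
the other bond, summed; `Σ'_n vhSAt κ′ (u′ + M∘n) = dper M (vhSAt κ′ u′)` (`dper_apply_of_blockCov`). -/
theorem sum_borderT2_sub_inr_inl (hM : ∀ i, M i = L * M' i)
    (hV : V = fun κ u x z a c => ∑' n : Site (d + 1), (1 / 2 : ℝ) * (vh₂SAt (toSite r) L κ u κ' (translate M u' n) x z a c + vh₂SAt (toSite r) L κ' (translate M u' n) κ u x z a c))
    (w x z : Site (d + 1)) (μ α : Fin (d + 1)) :
    ∑ κ : Fin (d + 1), (V κ (w - unitVec κ) x z (Sum.inr μ) (Sum.inl α) - V κ w x z (Sum.inr μ) (Sum.inl α))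
      = ((if x + toSite r = w then (1 : ℝ) else 0) - (if z = w then 1 else 0))
          * dper M (vhSAt (toSite r) d L rfl κ' u') x z (Sum.inr μ) (Sum.inl α) := by
  have hL : 1 ≤ L := Nat.one_le_iff_ne_zero.mpr (NeZero.ne L)
  subst hV
  -- termwise difference of two convergent copy sums, then the finite `κ`-sum inside the `n`-sum
  have hsum : ∀ κ : Fin (d + 1),
      (∑' n : Site (d + 1), (1 / 2 : ℝ) * (vh₂SAt (toSite r) L κ (w - unitVec κ) κ' (translate M u' n) x z (Sum.inr μ) (Sum.inl α)
          + vh₂SAt (toSite r) L κ' (translate M u' n) κ (w - unitVec κ) x z (Sum.inr μ) (Sum.inl α)))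
        - (∑' n : Site (d + 1), (1 / 2 : ℝ) * (vh₂SAt (toSite r) L κ w κ' (translate M u' n) x z (Sum.inr μ) (Sum.inl α)
          + vh₂SAt (toSite r) L κ' (translate M u' n) κ w x z (Sum.inr μ) (Sum.inl α)))
      = ∑' n : Site (d + 1), ((1 / 2 : ℝ) * (vh₂SAt (toSite r) L κ (w - unitVec κ) κ' (translate M u' n) x z (Sum.inr μ) (Sum.inl α)
          + vh₂SAt (toSite r) L κ' (translate M u' n) κ (w - unitVec κ) x z (Sum.inr μ) (Sum.inl α))
        - (1 / 2 : ℝ) * (vh₂SAt (toSite r) L κ w κ' (translate M u' n) x z (Sum.inr μ) (Sum.inl α)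
          + vh₂SAt (toSite r) L κ' (translate M u' n) κ w x z (Sum.inr μ) (Sum.inl α))) := fun κ =>
    ((summable_pair_translate_inr_inl hr κ' u' κ (w - unitVec κ) x z μ α).tsum_sub (summable_pair_translate_inr_inl hr κ' u' κ w x z μ α)).symm
  simp only [hsum]
  rw [← Summable.tsum_finsetSum (fun κ _ => (summable_pair_translate_inr_inl hr κ' u' κ (w - unitVec κ) x z μ α).sub
    (summable_pair_translate_inr_inl hr κ' u' κ w x z μ α))]
  -- the (W2-B) letter, copy by copy
  rw [tsum_congr fun n => sum_pair_sub_inr_inl hL (toSite r) κ' (translate M u' n) w x z μ α, tsum_mul_left,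
    dper_apply_of_blockCov hM (fun κ u t => vhSAt_translate (toSite r) hL κ u t) κ' u' x z (Sum.inr μ) (Sum.inl α)]

/-- [folklore] **`sum_tgrad_mul_perZ_dper_borderT2` — THE PERIODISED ROOTED SECOND-ORDER BORDER PAIR ALONG A TORUS PURE GAUGE IN ITS FIRST BOND** (`M = L·M′`; an2's
period-lattice engine `sum_tgrad_mul_perZ_dper_of_indexLaw_periodCov` fed I-2's covariance ∕ window letters and this §2's `hlaw`): for the torus gauge parameter `s`,
the multiplier row `(x, μ)` and the fluctuation leg `(z, α)`,
`Σ_{u ∈ pbox M} Σ_κ tgrad M (u, inl κ) s · perZ M (dper M (V κ u)) x z (inr μ) (inl α) = (tdelta M (x + ρ) s − tdelta M z s) · perZ M (dper M (vhSAt ρ d L rfl κ′ u′)) x z (inr μ) (inl α)`. -/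
theorem sum_tgrad_mul_perZ_dper_borderT2 (hM : ∀ i, M i = L * M' i)
    (hV : V = fun κ u x z a c => ∑' n : Site (d + 1), (1 / 2 : ℝ) * (vh₂SAt (toSite r) L κ u κ' (translate M u' n) x z a c + vh₂SAt (toSite r) L κ' (translate M u' n) κ u x z a c))
    (s : ↥(pbox M)) (x z : Site (d + 1)) (μ α : Fin (d + 1)) :
    ∑ u : ↥(pbox M), ∑ κ : Fin (d + 1), tgrad M (u, Sum.inl κ) s * perZ M (dper M (V κ (u : Site (d + 1)))) x z (Sum.inr μ) (Sum.inl α)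
      = (tdelta M (x + toSite r) s - tdelta M z s) * perZ M (dper M (vhSAt (toSite r) d L rfl κ' u')) x z (Sum.inr μ) (Sum.inl α) :=
  sum_tgrad_mul_perZ_dper_of_indexLaw_periodCov V (dper M (vhSAt (toSite r) d L rfl κ' u')) (fun x => x + toSite r)
    (fun x => nearBox L (blk L x)) (fun x => nearBox L (blk L x)) (Sum.inr μ) (Sum.inl α)
    (borderT2_periodCov κ' u' hM hV) (fun κ u x => borderT2_inr_inl_eq_zero_of_not_mem_S hr κ' u' hV κ u x μ α)
    (fun κ x z => borderT2_inr_inl_eq_zero_of_not_mem_T hr κ' u' hV κ x z μ α) (fun x => dper_vhSAt_inr_inl_eq_zero_of_not_mem hr κ' u' hM x μ α)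
    (fun w x z => sum_borderT2_sub_inr_inl hr κ' u' hM hV w x z μ α) s x z

end Family

/-! ## §3 Matrix forms: any box `M = L·M′`, any multiplier presentation `a ↦ (pμ a, inr (mμ a))` -/

section Torus

variable {M M' : Fin (d + 1) → ℕ} [∀ μ, NeZero (M μ)] {L : ℕ} [NeZero L] {r : Fin (d + 1) → ℕ} (hr : r ∈ box (d + 1) L)
  {W : Fin (d + 1) → Site (d + 1) → Fin (d + 1) → Site (d + 1) → MKer (d + 1) (Fib d)}
  {κI : Type*} [Fintype κI] [DecidableEq κI]
include hr

/-- [folklore] **`torus_T2_pureGauge_fst_of_presentation` — THE TORUS PAIR MEMBER ALONG A TORUS GAUGE MODE IN ITS FIRST BOND** (bi-family bound with the SECOND bond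
first: `hW : W = fun κ′ u′ κ u x z a c => Σ'_n ½(S₂ κ u κ′ (u′+M∘n) + S₂ κ′ (u′+M∘n) κ u) x z a c`; rows `a ↦ (pμ a, inr (mμ a))`, `pμ a ∈ pbox M`; columns `b ↦ (b.1, inl b.2)`):
for the second torus bond `β` and every torus gauge parameter `s`,
`Σ_b tgrad M (b.1, inl b.2) s • T^{b,β} = R_s * M^{β} − M^{β} * E_s`, `T^{b,β} := (perF M (dper M (W β.2 ↑β.1 b.2 ↑b.1))).submatrix …`,
`M^{β} := (perF M (dper M (vhSAt ρ d L rfl β.2 ↑β.1))).submatrix …` (C1's rooted first-order member), `E_s := diagonal (tdelta M b.1 s)` (a field leg rotates at the BASE of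
its bond), `R_s := diagonal (tdelta M (pμ a + ρ) s)` (a multiplier rotates at the ROOT of its block — g18's rotations; NO `c_j`). -/
theorem torus_T2_pureGauge_fst_of_presentation (hM : ∀ i, M i = L * M' i)
    (hW : W = fun κ' u' κ u x z a c => ∑' n : Site (d + 1), (1 / 2 : ℝ) * (vh₂SAt (toSite r) L κ u κ' (translate M u' n) x z a c + vh₂SAt (toSite r) L κ' (translate M u' n) κ u x z a c))
    (pμ : κI → Site (d + 1)) (hpμ : ∀ a, pμ a ∈ pbox M) (mμ : κI → Fin (d + 1)) (β : ↥(pbox M) × Fin (d + 1)) (s : ↥(pbox M)) :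
    (∑ b : ↥(pbox M) × Fin (d + 1), tgrad M (b.1, Sum.inl b.2) s •
        (perF M (dper M (W β.2 (β.1 : Site (d + 1)) b.2 (b.1 : Site (d + 1))))).submatrix
          (fun a : κI => ((⟨pμ a, hpμ a⟩, Sum.inr (mμ a)) : Idx M (Fib d)))
          (fun b : ↥(pbox M) × Fin (d + 1) => ((b.1, Sum.inl b.2) : Idx M (Fib d))))
      = Matrix.diagonal (fun a : κI => tdelta M (pμ a + toSite r) s)
            * (perF M (dper M (vhSAt (toSite r) d L rfl β.2 (β.1 : Site (d + 1))))).submatrix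
              (fun a : κI => ((⟨pμ a, hpμ a⟩, Sum.inr (mμ a)) : Idx M (Fib d)))
              (fun b : ↥(pbox M) × Fin (d + 1) => ((b.1, Sum.inl b.2) : Idx M (Fib d)))
          - (perF M (dper M (vhSAt (toSite r) d L rfl β.2 (β.1 : Site (d + 1))))).submatrix
              (fun a : κI => ((⟨pμ a, hpμ a⟩, Sum.inr (mμ a)) : Idx M (Fib d)))
              (fun b : ↥(pbox M) × Fin (d + 1) => ((b.1, Sum.inl b.2) : Idx M (Fib d)))
            * Matrix.diagonal (fun b : ↥(pbox M) × Fin (d + 1) => tdelta M (b.1 : Site (d + 1)) s) := by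
  have hV : W β.2 (β.1 : Site (d + 1)) = fun κ u x z a c => ∑' n : Site (d + 1), (1 / 2 : ℝ) *
      (vh₂SAt (toSite r) L κ u β.2 (translate M (β.1 : Site (d + 1)) n) x z a c + vh₂SAt (toSite r) L β.2 (translate M (β.1 : Site (d + 1)) n) κ u x z a c) := by
    rw [hW]
  ext a b'
  rw [Matrix.sum_apply, Matrix.sub_apply, Matrix.diagonal_mul, Matrix.mul_diagonal]
  simp only [Matrix.smul_apply, Matrix.submatrix_apply, perF_apply, smul_eq_mul]
  rw [Fintype.sum_prod_type]
  rw [sum_tgrad_mul_perZ_dper_borderT2 (M := M) (M' := M') hr β.2 (β.1 : Site (d + 1)) hM hV s _ _ (mμ a) b'.2]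
  ring

/-- [folklore] **ANY TORUS GAUGE FUNCTION** `λ : ↥(pbox M) → ℝ` (`(Dλ)_b := Σ_s tgrad M b s · λ s`): `Σ_b (Dλ)_b • T^{b,β} = R_λ * M^{β} − M^{β} * E_λ`,
`E_λ := diagonal (λ b.1)`, `R_λ := diagonal (Σ_s tdelta M (pμ a + ρ) s · λ s)`. -/
theorem torus_T2_pureGauge_fst_fun_of_presentation (hM : ∀ i, M i = L * M' i)
    (hW : W = fun κ' u' κ u x z a c => ∑' n : Site (d + 1), (1 / 2 : ℝ) * (vh₂SAt (toSite r) L κ u κ' (translate M u' n) x z a c + vh₂SAt (toSite r) L κ' (translate M u' n) κ u x z a c))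
    (pμ : κI → Site (d + 1)) (hpμ : ∀ a, pμ a ∈ pbox M) (mμ : κI → Fin (d + 1)) (β : ↥(pbox M) × Fin (d + 1)) (lam : ↥(pbox M) → ℝ) :
    (∑ b : ↥(pbox M) × Fin (d + 1), (∑ s : ↥(pbox M), tgrad M (b.1, Sum.inl b.2) s * lam s) •
        (perF M (dper M (W β.2 (β.1 : Site (d + 1)) b.2 (b.1 : Site (d + 1))))).submatrix
          (fun a : κI => ((⟨pμ a, hpμ a⟩, Sum.inr (mμ a)) : Idx M (Fib d)))
          (fun b : ↥(pbox M) × Fin (d + 1) => ((b.1, Sum.inl b.2) : Idx M (Fib d))))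
      = Matrix.diagonal (fun a : κI => ∑ s : ↥(pbox M), tdelta M (pμ a + toSite r) s * lam s)
            * (perF M (dper M (vhSAt (toSite r) d L rfl β.2 (β.1 : Site (d + 1))))).submatrix
              (fun a : κI => ((⟨pμ a, hpμ a⟩, Sum.inr (mμ a)) : Idx M (Fib d)))
              (fun b : ↥(pbox M) × Fin (d + 1) => ((b.1, Sum.inl b.2) : Idx M (Fib d)))
          - (perF M (dper M (vhSAt (toSite r) d L rfl β.2 (β.1 : Site (d + 1))))).submatrix
              (fun a : κI => ((⟨pμ a, hpμ a⟩, Sum.inr (mμ a)) : Idx M (Fib d)))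
              (fun b : ↥(pbox M) × Fin (d + 1) => ((b.1, Sum.inl b.2) : Idx M (Fib d)))
            * Matrix.diagonal (fun b : ↥(pbox M) × Fin (d + 1) => lam b.1) := by
  have hswap : (∑ b : ↥(pbox M) × Fin (d + 1), (∑ s : ↥(pbox M), tgrad M (b.1, Sum.inl b.2) s * lam s) •
        (perF M (dper M (W β.2 (β.1 : Site (d + 1)) b.2 (b.1 : Site (d + 1))))).submatrix
          (fun a : κI => ((⟨pμ a, hpμ a⟩, Sum.inr (mμ a)) : Idx M (Fib d)))
          (fun b : ↥(pbox M) × Fin (d + 1) => ((b.1, Sum.inl b.2) : Idx M (Fib d))))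
      = ∑ s : ↥(pbox M), lam s • ∑ b : ↥(pbox M) × Fin (d + 1), tgrad M (b.1, Sum.inl b.2) s •
        (perF M (dper M (W β.2 (β.1 : Site (d + 1)) b.2 (b.1 : Site (d + 1))))).submatrix
          (fun a : κI => ((⟨pμ a, hpμ a⟩, Sum.inr (mμ a)) : Idx M (Fib d)))
          (fun b : ↥(pbox M) × Fin (d + 1) => ((b.1, Sum.inl b.2) : Idx M (Fib d))) := by
    simp only [Finset.sum_smul, Finset.smul_sum, smul_smul, mul_comm (lam _)]
    exact Finset.sum_comm
  rw [hswap, Finset.sum_congr rfl fun s _ => by rw [torus_T2_pureGauge_fst_of_presentation hr hM hW pμ hpμ mμ β s]]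
  ext a b'
  simp only [Matrix.sum_apply, Matrix.smul_apply, Matrix.sub_apply, Matrix.diagonal_mul, Matrix.mul_diagonal, smul_eq_mul]
  rw [show lam b'.1 = ∑ s : ↥(pbox M), tdelta M ((b'.1 : ↥(pbox M)) : Site (d + 1)) s * lam s by rw [sum_tdelta_mul, wrapPt_of_mem]]
  simp only [Finset.mul_sum, Finset.sum_mul, mul_sub, Finset.sum_sub_distrib]
  congr 1 <;> exact Finset.sum_congr rfl fun s _ => by ring

end Torus

/-! ## §4 The pair swap on the `(inr, inl)` block; the second-slot law; the bi-weighted forms -/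

section Symmetry

variable {M M' : Fin (d + 1) → ℕ} [∀ μ, NeZero (M μ)] {L : ℕ} [NeZero L] {r : Fin (d + 1) → ℕ} (hr : r ∈ box (d + 1) L)
  {W : Fin (d + 1) → Site (d + 1) → Fin (d + 1) → Site (d + 1) → MKer (d + 1) (Fib d)}
  {κI : Type*} [Fintype κI] [DecidableEq κI]
include hr

omit [∀ μ, NeZero (M μ)] hr in
/-- [folklore] **THE MEMBER's KERNEL IS THE DOUBLE COPY SUM** (`M = L·M′`): `dper M (W κ′ u′ κ u) x z a c = Σ'_m Σ'_n ½(S₂ κ (u+M∘m) κ′ (u′+M∘n) + S₂ κ′ (u′+M∘n) κ (u+M∘m)) x z a c`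
(an2's `dper_apply_of_periodCov` + I-2's `borderT2_periodCov`). -/
theorem dper_borderT2_apply (hM : ∀ i, M i = L * M' i)
    (hW : W = fun κ' u' κ u x z a c => ∑' n : Site (d + 1), (1 / 2 : ℝ) * (vh₂SAt (toSite r) L κ u κ' (translate M u' n) x z a c + vh₂SAt (toSite r) L κ' (translate M u' n) κ u x z a c))
    (κ' : Fin (d + 1)) (u' : Site (d + 1)) (κ : Fin (d + 1)) (u x z : Site (d + 1)) (a c : Fib d) :
    dper M (W κ' u' κ u) x z a c = ∑' m : Site (d + 1), ∑' n : Site (d + 1), (1 / 2 : ℝ) *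
      (vh₂SAt (toSite r) L κ (translate M u m) κ' (translate M u' n) x z a c + vh₂SAt (toSite r) L κ' (translate M u' n) κ (translate M u m) x z a c) := by
  have hV : W κ' u' = fun κ u x z a c => ∑' n : Site (d + 1), (1 / 2 : ℝ) *
      (vh₂SAt (toSite r) L κ u κ' (translate M u' n) x z a c + vh₂SAt (toSite r) L κ' (translate M u' n) κ u x z a c) := by rw [hW]
  rw [dper_apply_of_periodCov (W κ' u') (borderT2_periodCov κ' u' hM hV) κ u x z a c, hV]

omit [NeZero L] in
/-- [folklore] the double copy sum commutes on the `(inr μ, inl α)` block (both copy indices range over the finite window `nearBox L (blk L x)` — I-2's support letter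
`pair_inr_inl_eq_zero_of_not_mem` in either bond). -/
theorem tsum_tsum_pair_comm_inr_inl (κ : Fin (d + 1)) (u : Site (d + 1)) (κ' : Fin (d + 1)) (u' x z : Site (d + 1)) (μ α : Fin (d + 1)) :
    ∑' m : Site (d + 1), ∑' n : Site (d + 1), (1 / 2 : ℝ) * (vh₂SAt (toSite r) L κ (translate M u m) κ' (translate M u' n) x z (Sum.inr μ) (Sum.inl α)
        + vh₂SAt (toSite r) L κ' (translate M u' n) κ (translate M u m) x z (Sum.inr μ) (Sum.inl α))
      = ∑' n : Site (d + 1), ∑' m : Site (d + 1), (1 / 2 : ℝ) * (vh₂SAt (toSite r) L κ (translate M u m) κ' (translate M u' n) x z (Sum.inr μ) (Sum.inl α)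
        + vh₂SAt (toSite r) L κ' (translate M u' n) κ (translate M u m) x z (Sum.inr μ) (Sum.inl α)) :=
  tsum_tsum_comm_of_support (fun m n => (1 / 2 : ℝ) * (vh₂SAt (toSite r) L κ (translate M u m) κ' (translate M u' n) x z (Sum.inr μ) (Sum.inl α)
      + vh₂SAt (toSite r) L κ' (translate M u' n) κ (translate M u m) x z (Sum.inr μ) (Sum.inl α)))
    ((nearBox L (blk L x)).preimage (fun m => translate M u m) (translate_injective (M := M) u).injOn)
    ((nearBox L (blk L x)).preimage (fun n => translate M u' n) (translate_injective (M := M) u').injOn)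
    (fun _ hm _ => pair_inr_inl_eq_zero_of_not_mem hr κ _ κ' _ x z μ α (Or.inr (Or.inl fun h => hm (Finset.mem_preimage.2 h))))
    (fun _ hn _ => pair_inr_inl_eq_zero_of_not_mem hr κ _ κ' _ x z μ α (Or.inr (Or.inr fun h => hn (Finset.mem_preimage.2 h))))

/-- [folklore] **PAIR SYMMETRY OF THE TORUS MEMBER ON THE `(inr, inl)` BLOCK**: `dper M (W κ′ u′ κ u) x z (inr μ) (inl α) = dper M (W κ u κ′ u′) x z (inr μ) (inl α)` —
the pair is symmetrised copy by copy, so only the two copy sums are exchanged (finite-rectangle Fubini); no anti-twin, no other block. -/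
theorem dper_borderT2_swap_inr_inl (hM : ∀ i, M i = L * M' i)
    (hW : W = fun κ' u' κ u x z a c => ∑' n : Site (d + 1), (1 / 2 : ℝ) * (vh₂SAt (toSite r) L κ u κ' (translate M u' n) x z a c + vh₂SAt (toSite r) L κ' (translate M u' n) κ u x z a c))
    (κ' : Fin (d + 1)) (u' : Site (d + 1)) (κ : Fin (d + 1)) (u x z : Site (d + 1)) (μ α : Fin (d + 1)) :
    dper M (W κ' u' κ u) x z (Sum.inr μ) (Sum.inl α) = dper M (W κ u κ' u') x z (Sum.inr μ) (Sum.inl α) := by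
  rw [dper_borderT2_apply hM hW, dper_borderT2_apply hM hW, tsum_tsum_pair_comm_inr_inl hr κ u κ' u' x z μ α]
  exact tsum_congr fun n => tsum_congr fun m => by ring

omit [Fintype κI] [DecidableEq κI] in
/-- [folklore] pair symmetry at the matrix level: `T^{b,b′} = T^{b′,b}` in any multiplier presentation `a ↦ (pμ a, inr (mμ a))`. -/
theorem submatrix_perF_dper_borderT2_swap (hM : ∀ i, M i = L * M' i)
    (hW : W = fun κ' u' κ u x z a c => ∑' n : Site (d + 1), (1 / 2 : ℝ) * (vh₂SAt (toSite r) L κ u κ' (translate M u' n) x z a c + vh₂SAt (toSite r) L κ' (translate M u' n) κ u x z a c))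
    (pμ : κI → Site (d + 1)) (hpμ : ∀ a, pμ a ∈ pbox M) (mμ : κI → Fin (d + 1)) (b b' : ↥(pbox M) × Fin (d + 1)) :
    (perF M (dper M (W b'.2 (b'.1 : Site (d + 1)) b.2 (b.1 : Site (d + 1))))).submatrix
          (fun a : κI => ((⟨pμ a, hpμ a⟩, Sum.inr (mμ a)) : Idx M (Fib d)))
          (fun c : ↥(pbox M) × Fin (d + 1) => ((c.1, Sum.inl c.2) : Idx M (Fib d)))
      = (perF M (dper M (W b.2 (b.1 : Site (d + 1)) b'.2 (b'.1 : Site (d + 1))))).submatrix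
          (fun a : κI => ((⟨pμ a, hpμ a⟩, Sum.inr (mμ a)) : Idx M (Fib d)))
          (fun c : ↥(pbox M) × Fin (d + 1) => ((c.1, Sum.inl c.2) : Idx M (Fib d))) := by
  ext a c
  simp only [Matrix.submatrix_apply, perF_apply, perZ_apply]
  exact tsum_congr fun m => dper_borderT2_swap_inr_inl hr hM hW _ _ _ _ _ _ _ _

/-- [folklore] **`torus_T2_pureGauge_snd_fun_of_presentation` — A TORUS PURE GAUGE IN THE SECOND BOND** (pair symmetry + §3): for every torus bond `b` and torus gauge
function `λ`, `Σ_{b′} (Dλ)_{b′} • T^{b,b′} = R_λ * M^{b} − M^{b} * E_λ`. -/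
theorem torus_T2_pureGauge_snd_fun_of_presentation (hM : ∀ i, M i = L * M' i)
    (hW : W = fun κ' u' κ u x z a c => ∑' n : Site (d + 1), (1 / 2 : ℝ) * (vh₂SAt (toSite r) L κ u κ' (translate M u' n) x z a c + vh₂SAt (toSite r) L κ' (translate M u' n) κ u x z a c))
    (pμ : κI → Site (d + 1)) (hpμ : ∀ a, pμ a ∈ pbox M) (mμ : κI → Fin (d + 1)) (b : ↥(pbox M) × Fin (d + 1)) (lam : ↥(pbox M) → ℝ) :
    (∑ b' : ↥(pbox M) × Fin (d + 1), (∑ s : ↥(pbox M), tgrad M (b'.1, Sum.inl b'.2) s * lam s) •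
        (perF M (dper M (W b'.2 (b'.1 : Site (d + 1)) b.2 (b.1 : Site (d + 1))))).submatrix
          (fun a : κI => ((⟨pμ a, hpμ a⟩, Sum.inr (mμ a)) : Idx M (Fib d)))
          (fun c : ↥(pbox M) × Fin (d + 1) => ((c.1, Sum.inl c.2) : Idx M (Fib d))))
      = Matrix.diagonal (fun a : κI => ∑ s : ↥(pbox M), tdelta M (pμ a + toSite r) s * lam s)
            * (perF M (dper M (vhSAt (toSite r) d L rfl b.2 (b.1 : Site (d + 1))))).submatrix
              (fun a : κI => ((⟨pμ a, hpμ a⟩, Sum.inr (mμ a)) : Idx M (Fib d)))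
              (fun c : ↥(pbox M) × Fin (d + 1) => ((c.1, Sum.inl c.2) : Idx M (Fib d)))
          - (perF M (dper M (vhSAt (toSite r) d L rfl b.2 (b.1 : Site (d + 1))))).submatrix
              (fun a : κI => ((⟨pμ a, hpμ a⟩, Sum.inr (mμ a)) : Idx M (Fib d)))
              (fun c : ↥(pbox M) × Fin (d + 1) => ((c.1, Sum.inl c.2) : Idx M (Fib d)))
            * Matrix.diagonal (fun c : ↥(pbox M) × Fin (d + 1) => lam c.1) := by
  rw [Finset.sum_congr rfl fun b' _ => by rw [submatrix_perF_dper_borderT2_swap hr hM hW pμ hpμ mμ b b']]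
  exact torus_T2_pureGauge_fst_fun_of_presentation hr hM hW pμ hpμ mμ b lam

/-- [folklore] **BI-WEIGHTED, GAUGE IN THE FIRST SLOT** (any box, any multiplier presentation): `Σ_b Σ_{b′} ((Dλ)_b · g b′) • T^{b,b′} = R_λ * M^{(g)} − M^{(g)} * E_λ`,
`M^{(g)} := Σ_{b′} g b′ • M^{b′}` (§3 at each second bond, summed). -/
theorem torus_T2_gauge_fst_of_presentation (hM : ∀ i, M i = L * M' i)
    (hW : W = fun κ' u' κ u x z a c => ∑' n : Site (d + 1), (1 / 2 : ℝ) * (vh₂SAt (toSite r) L κ u κ' (translate M u' n) x z a c + vh₂SAt (toSite r) L κ' (translate M u' n) κ u x z a c))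
    (pμ : κI → Site (d + 1)) (hpμ : ∀ a, pμ a ∈ pbox M) (mμ : κI → Fin (d + 1)) (g : ↥(pbox M) × Fin (d + 1) → ℝ) (lam : ↥(pbox M) → ℝ) :
    (∑ b : ↥(pbox M) × Fin (d + 1), ∑ b' : ↥(pbox M) × Fin (d + 1), ((∑ s : ↥(pbox M), tgrad M (b.1, Sum.inl b.2) s * lam s) * g b') •
        (perF M (dper M (W b'.2 (b'.1 : Site (d + 1)) b.2 (b.1 : Site (d + 1))))).submatrix
          (fun a : κI => ((⟨pμ a, hpμ a⟩, Sum.inr (mμ a)) : Idx M (Fib d)))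
          (fun c : ↥(pbox M) × Fin (d + 1) => ((c.1, Sum.inl c.2) : Idx M (Fib d))))
      = Matrix.diagonal (fun a : κI => ∑ s : ↥(pbox M), tdelta M (pμ a + toSite r) s * lam s)
            * (∑ b' : ↥(pbox M) × Fin (d + 1), g b' • (perF M (dper M (vhSAt (toSite r) d L rfl b'.2 (b'.1 : Site (d + 1))))).submatrix
              (fun a : κI => ((⟨pμ a, hpμ a⟩, Sum.inr (mμ a)) : Idx M (Fib d)))
              (fun c : ↥(pbox M) × Fin (d + 1) => ((c.1, Sum.inl c.2) : Idx M (Fib d))))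
          - (∑ b' : ↥(pbox M) × Fin (d + 1), g b' • (perF M (dper M (vhSAt (toSite r) d L rfl b'.2 (b'.1 : Site (d + 1))))).submatrix
              (fun a : κI => ((⟨pμ a, hpμ a⟩, Sum.inr (mμ a)) : Idx M (Fib d)))
              (fun c : ↥(pbox M) × Fin (d + 1) => ((c.1, Sum.inl c.2) : Idx M (Fib d))))
            * Matrix.diagonal (fun c : ↥(pbox M) × Fin (d + 1) => lam c.1) := by
  rw [Finset.sum_comm]
  have hinner : ∀ b' : ↥(pbox M) × Fin (d + 1),
      (∑ b : ↥(pbox M) × Fin (d + 1), ((∑ s : ↥(pbox M), tgrad M (b.1, Sum.inl b.2) s * lam s) * g b') •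
          (perF M (dper M (W b'.2 (b'.1 : Site (d + 1)) b.2 (b.1 : Site (d + 1))))).submatrix
            (fun a : κI => ((⟨pμ a, hpμ a⟩, Sum.inr (mμ a)) : Idx M (Fib d)))
            (fun c : ↥(pbox M) × Fin (d + 1) => ((c.1, Sum.inl c.2) : Idx M (Fib d))))
        = g b' • (Matrix.diagonal (fun a : κI => ∑ s : ↥(pbox M), tdelta M (pμ a + toSite r) s * lam s)
            * (perF M (dper M (vhSAt (toSite r) d L rfl b'.2 (b'.1 : Site (d + 1))))).submatrix
              (fun a : κI => ((⟨pμ a, hpμ a⟩, Sum.inr (mμ a)) : Idx M (Fib d)))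
              (fun c : ↥(pbox M) × Fin (d + 1) => ((c.1, Sum.inl c.2) : Idx M (Fib d)))
          - (perF M (dper M (vhSAt (toSite r) d L rfl b'.2 (b'.1 : Site (d + 1))))).submatrix
              (fun a : κI => ((⟨pμ a, hpμ a⟩, Sum.inr (mμ a)) : Idx M (Fib d)))
              (fun c : ↥(pbox M) × Fin (d + 1) => ((c.1, Sum.inl c.2) : Idx M (Fib d)))
            * Matrix.diagonal (fun c : ↥(pbox M) × Fin (d + 1) => lam c.1)) := fun b' => by
    rw [← torus_T2_pureGauge_fst_fun_of_presentation hr hM hW pμ hpμ mμ b' lam, Finset.smul_sum]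
    exact Finset.sum_congr rfl fun b _ => by rw [mul_comm, smul_smul]
  rw [Finset.sum_congr rfl fun b' _ => hinner b']
  simp only [smul_sub, Finset.sum_sub_distrib, Matrix.mul_sum, Matrix.sum_mul, Matrix.mul_smul, Matrix.smul_mul]

/-- [folklore] **BI-WEIGHTED, GAUGE IN THE SECOND SLOT** (any box, any multiplier presentation): `Σ_b Σ_{b′} (g b · (Dλ)_{b′}) • T^{b,b′} = R_λ * M^{(g)} − M^{(g)} * E_λ`
(the second-slot law at each first bond `b`, summed). -/
theorem torus_T2_gauge_snd_of_presentation (hM : ∀ i, M i = L * M' i)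
    (hW : W = fun κ' u' κ u x z a c => ∑' n : Site (d + 1), (1 / 2 : ℝ) * (vh₂SAt (toSite r) L κ u κ' (translate M u' n) x z a c + vh₂SAt (toSite r) L κ' (translate M u' n) κ u x z a c))
    (pμ : κI → Site (d + 1)) (hpμ : ∀ a, pμ a ∈ pbox M) (mμ : κI → Fin (d + 1)) (g : ↥(pbox M) × Fin (d + 1) → ℝ) (lam : ↥(pbox M) → ℝ) :
    (∑ b : ↥(pbox M) × Fin (d + 1), ∑ b' : ↥(pbox M) × Fin (d + 1), (g b * ∑ s : ↥(pbox M), tgrad M (b'.1, Sum.inl b'.2) s * lam s) •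
        (perF M (dper M (W b'.2 (b'.1 : Site (d + 1)) b.2 (b.1 : Site (d + 1))))).submatrix
          (fun a : κI => ((⟨pμ a, hpμ a⟩, Sum.inr (mμ a)) : Idx M (Fib d)))
          (fun c : ↥(pbox M) × Fin (d + 1) => ((c.1, Sum.inl c.2) : Idx M (Fib d))))
      = Matrix.diagonal (fun a : κI => ∑ s : ↥(pbox M), tdelta M (pμ a + toSite r) s * lam s)
            * (∑ b : ↥(pbox M) × Fin (d + 1), g b • (perF M (dper M (vhSAt (toSite r) d L rfl b.2 (b.1 : Site (d + 1))))).submatrix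
              (fun a : κI => ((⟨pμ a, hpμ a⟩, Sum.inr (mμ a)) : Idx M (Fib d)))
              (fun c : ↥(pbox M) × Fin (d + 1) => ((c.1, Sum.inl c.2) : Idx M (Fib d))))
          - (∑ b : ↥(pbox M) × Fin (d + 1), g b • (perF M (dper M (vhSAt (toSite r) d L rfl b.2 (b.1 : Site (d + 1))))).submatrix
              (fun a : κI => ((⟨pμ a, hpμ a⟩, Sum.inr (mμ a)) : Idx M (Fib d)))
              (fun c : ↥(pbox M) × Fin (d + 1) => ((c.1, Sum.inl c.2) : Idx M (Fib d))))
            * Matrix.diagonal (fun c : ↥(pbox M) × Fin (d + 1) => lam c.1) := by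
  have hinner : ∀ b : ↥(pbox M) × Fin (d + 1),
      (∑ b' : ↥(pbox M) × Fin (d + 1), (g b * ∑ s : ↥(pbox M), tgrad M (b'.1, Sum.inl b'.2) s * lam s) •
          (perF M (dper M (W b'.2 (b'.1 : Site (d + 1)) b.2 (b.1 : Site (d + 1))))).submatrix
            (fun a : κI => ((⟨pμ a, hpμ a⟩, Sum.inr (mμ a)) : Idx M (Fib d)))
            (fun c : ↥(pbox M) × Fin (d + 1) => ((c.1, Sum.inl c.2) : Idx M (Fib d))))
        = g b • (Matrix.diagonal (fun a : κI => ∑ s : ↥(pbox M), tdelta M (pμ a + toSite r) s * lam s)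
            * (perF M (dper M (vhSAt (toSite r) d L rfl b.2 (b.1 : Site (d + 1))))).submatrix
              (fun a : κI => ((⟨pμ a, hpμ a⟩, Sum.inr (mμ a)) : Idx M (Fib d)))
              (fun c : ↥(pbox M) × Fin (d + 1) => ((c.1, Sum.inl c.2) : Idx M (Fib d)))
          - (perF M (dper M (vhSAt (toSite r) d L rfl b.2 (b.1 : Site (d + 1))))).submatrix
              (fun a : κI => ((⟨pμ a, hpμ a⟩, Sum.inr (mμ a)) : Idx M (Fib d)))
              (fun c : ↥(pbox M) × Fin (d + 1) => ((c.1, Sum.inl c.2) : Idx M (Fib d)))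
            * Matrix.diagonal (fun c : ↥(pbox M) × Fin (d + 1) => lam c.1)) := fun b => by
    rw [← torus_T2_pureGauge_snd_fun_of_presentation hr hM hW pμ hpμ mμ b lam, Finset.smul_sum]
    exact Finset.sum_congr rfl fun b' _ => by rw [smul_smul]
  rw [Finset.sum_congr rfl fun b _ => hinner b]
  simp only [smul_sub, Finset.sum_sub_distrib, Matrix.mul_sum, Matrix.sum_mul, Matrix.mul_smul, Matrix.smul_mul]

end Symmetry

end Summit.QuantumFields.BalabanUV.Beta.FP.PeriodisedBorderIndexWardTwo

end
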